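import Summits.BirchSwinnertonDyer.BirchSwinnertonDyer.Theses.ErratumRoadFive
import Summits.BirchSwinnertonDyer.BirchSwinnertonDyer.Theorems.ErratumRoadFiveControlFromJSWMult
import Summits.BirchSwinnertonDyer.BirchSwinnertonDyer.Theorems.Rank1ResidualIntModelReduction
import Summits.BirchSwinnertonDyer.Rank1Residual.X11b.BDPRouteOpenInputTight
import Summits.BirchSwinnertonDyer.Rank1Residual.Additive.IntModelTamagawaCertificate
import Summits.BirchSwinnertonDyer.Rank1Residual.Additive.IntModelConductorCertificate
import Summits.BirchSwinnertonDyer.Rank1Residual.X11b.ChaPairsMinimality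
import Summits.BirchSwinnertonDyer.Rank1Residual.GaloisImage.FrobeniusOrderWitness
import Summits.BirchSwinnertonDyer.Rank1Residual.Supersingular.CountPointsFast
import HarnessLib

/-!
# Route `ErratumRoadFive` (rung K2, `p ≥ 5`), crux `OpenInputNotRam` (item stmt-BirchSwinnertonDyer-19282, ¬(ram)):
# the BC5 rung at the explicit pair `E = 6615d1`, `p = 5` — route p2's open input at the explicit classical field
# `K = ℚ(√−59)`, from PUBLISHED named facts, ONE kernel Tate certificate and ONE attested Heegner-index certificate

Cell `bsd-stepL` (run/shared/lean/pub/bsd-stepL/), seat `bsd-stepL-imc-p1` (prover g6, 2026-08-26);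
`--supports stmt-BirchSwinnertonDyer-19282 --as helper` (lineage: crux 19061 `OpenInputIMC` → child 19282).

HONEST FRAMING: THEOREMS ONLY (no definition, no named fact, no instance, no `sorry`; axioms standard); nothing is
booked; BSD is proved for no class and no pair; the rung is ONE curve at ONE field, closes no item, and is CONDITIONAL
on the displayed published facts AND on the attested certificate binder (a Heegner point is the image of the analytic
modular parametrisation — not kernel-checkable today). PARTITION (D-0054): X11b@p≥5 (B9 ∕ N8) × the ¬(ram) pair
`(6615d1, 5)` (the judge's BC5 witness of 19282: `N = 6615 = 3³·5·7²`, split `I₅` at `5` with `c₅ = 5`, `3` and `7`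
ADDITIVE — so NO multiplicative prime `ℓ ≠ 5` exists and the pair is off every (ram)-based printed theorem —, `ρ̄_{E,5}`
onto, `r_an = 1`) × the classical Heegner field `ℚ(√−59)` — types-the-object-of; closes: none (T7).

## Why the REGISTERED rung `stub_rung_6615d1 : P2OpenInputOnTreeAt W6615d1 5` is not the certifiable object

`P2OpenInputOnTreeAt W p` quantifies over EVERY classical Heegener datum of the pair, i.e. over every imaginary
quadratic `K` with `3, 5, 7` split, `d_K` odd, `5 ∤ d_K`, `L(E^{d_K},1) ≠ 0`. Given the published control identity
(`ControlOnTreeAt`, Jetchev–Skinner–Wan Thm. 3.3.1 at the multiplicative `p`) the open input at such a `K` is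
EQUIVALENT to STEP L there (`imcLowerWaldspurgerOnTreeAt_iff_indexLowerBoundAt_of_controlOnTreeAt`), i.e. to the
`p`-part of the LOWER bound `#Ш(E/K) ≥ #Ш_an(E/K)`, which contains the rank-ZERO lower bound for the twist `E^{d_K}`.
At a (ram) pair that twist bound is Skinner 2016 Thm. C (the (ram) witness survives the twist: every `ℓ ∣ N` splits
in `K`) — this is how `P2.openInputOnTreeAt_of_bsdp_of_ram` closes the ∀-`K` rungs of the (ram) cruxes (5015b1,
5235a1, 5835a1). At a ¬(ram) pair EVERY twist `E^{d_K}` is ¬(ram) as well, and no refereed theorem gives the rank-0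
`BSD_5` lower bound for a ¬(ram) curve; the twists range over infinitely many `d_K`, so no finite certificate closes
the ∀-`K` statement either. The certifiable object is the open input AT ONE EXPLICIT FIELD (judge K2 direction (c) on
19282: «an explicit-`K` instance with content is the T3 target here») — §3 below, offered to the planner as the
re-typed rung (STATUS line of this seat).

## The pair (kit j257035, PARI 2.17; Cremona 6615d1)

`E = [1, −1, 1, −167, 816]`, `y² + xy + y = x³ − x² − 167x + 816`; `Δ = 37209375 = 3⁵·5⁵·7²`, `c₄ = 8001 = 3²·7·127`,
`c₆ = −669249`, `j = 43016043/3125`; `N = 6615 = 3³·5·7²` (Kodaira `IV` at `3`, `f₃ = 3`, `c₃ = 3`; `I₅` SPLIT at `5`,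
`a₅ = +1`, `c₅ = 5`; `II` at `7`, `f₇ = 2`, `c₇ = 1`; `∏_ℓ c_ℓ = 15`); `E(ℚ)_tors = 1`; `E(ℚ) = ℤ·g`, `g = (−4, 39)`,
`ĥ(g) = 0.08943…`; `r_an = 1`, `L′(E,1) = 2.69967…`, `Ш_an(E) = 1.000…` (120 digits); `E(ℚ₅)[5] ≅ ℤ/5` (two
`x`-roots of `ψ₅` in `ℚ₅`, each with both `y` in `ℚ₅` — erratum hypothesis (iv) FAILS here, consistently with
`5 ∣ c₅`). KERNEL-DECIDED below (§§1–2, `decide` on the literal model through the tree's certificate bridges): `Δ`,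
ellipticity, global minimality (Silverman's criterion at `3, 5, 7`: `ord Δ = 5, 5, 2 < 12`), the integral model, the
Tate row certificate at `3, 5, 7` (`TamLocal.rowCheck`: `IV` bracket `{1,3}`, `I₅` split `5`, `II` `1`) hence
`∏_ℓ c_ℓ ∈ {5, 15}` and `5 ∣ ∏_ℓ c_ℓ`, split multiplicative reduction at `5`, non-semistability, and the CONDUCTOR
`N = 6615 ≥ 5000` (root-number-with-3 + local Tate certificates at `2, 3`; Ogg at the wild prime `3`: `f₃ = 3`), and `ρ̄_{E,5}`
SURJECTIVE (Frobenius order witness `ℓ₁ = 17`, `ℓ₂ = 31`). NOT decided (carried by the predicate's own binder `ClassX11b`, as in every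
rung of this cell): `r_an = 1`.

## The certificate (kit j257035, `kit/heeg6615.gp` = rest-p2's `heegner_cert.gp` engine; evidence on item 19282)

`K = ℚ(√−59)`: `d_K = −59` odd, fundamental, `h(−59) = 3`, `(−59/3) = (−59/5) = (−59/7) = +1` (the Heegner
hypothesis for `N = 6615`; the smallest such `|d|`), `5 ∤ 59`, `w_K = 2`; `β = 709`; the Heegner point
`y_K = Σ_{[Q]} φ(τ_Q)` over the `3` Heegner forms of level `6615`, computed ANALYTICALLY (309 390 terms of the modular
parametrisation at 120 digits) and recognised in `E(ℂ) = ℂ/Λ` as **`y_K = 15·g`** to lattice distance `3·10⁻⁷²`;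
`E(K)_tors = 1`; `E^{(−59)}`: conductor `23026815`, analytic rank `0`, `L(E^{(−59)},1) = 2.6066… ≠ 0`,
`Ш_an(E^{(−59)}) = 1.000…`. Hence the HEEGNER INDEX `[E(K) : ℤ y_K] = 15 · 2^a` (`E(K) ⊇ E(ℚ) ⊕ E^{(−59)}(ℚ) = ℤg`
with `2`-power index, `E^{(−59)}(ℚ)` torsion-free of rank `0`, `E(K)_tors = 1`): **`ord₅ [E(K) : ℤ y_K] = 1`** — the
binder `hidx` of §3, stated for the data with `5 ∤ c` (Manin constant; `P = (c/c₀)·y_K` up to sign ∕ conjugation ∕ torsion, `c₀ = 1` for the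
optimal curve, so `ord₅` of the index is `1` exactly when `5 ∤ c`); the same recognition `y_K = ∓15·g` holds at `d = −131, −251, −299`. Gross–Zagier's conjecture
(Gross 1991 (2.2)) PREDICTS exactly this: `[E(K):ℤy_K]² = #Ш(E/K)·(∏_ℓ c_ℓ)²·…` with `∏ c_ℓ = 15` and
`Ш_an(E/K) = Ш_an(E)·Ш_an(E^{(−59)}) = 1`.

## The rung (§3) and its honest content

`rung_6615d1_d59_of_cert`: at every classical datum of `(E, 5)` over a field `K` with `NumberField.discr K = −59`
(the body of `P2OpenInputOnTreeAt E 5` with that ONE extra binder), `IMCLowerWaldspurgerOnTreeAt 5 κ 𝔭 γ (embAt K 5 𝔭) P`.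
Proof: the control identity at the datum from the Jetchev–Skinner–Wan fact + Kolyvagin (imc-t1's
`p2ControlOnTreeAt_of_thm331Mult`; any conductor, any Tamagawa numbers, split `p` with `p ∣ c_p` included); `Ш(E/K)`
finite (Kolyvagin at the datum's non-torsion Heegner point); STEP L `IndexLowerBoundAt E 5 K P`, i.e.
`2·ord₅[E(K):ℤP] ≤ ord₅ #Ш(E/K) + 2·ord₅ ∏_ℓ c_ℓ(E)`, from the certificate (`ord₅[E(K):ℤP] ≤ 1`) and the kernel
Tamagawa fact (`1 ≤ ord₅ ∏_ℓ c_ℓ`) — `2 ≤ 0 + 2`; then multr1-p2's tightness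
`imcLowerWaldspurgerOnTreeAt_of_controlOnTreeAt_of_indexLowerBoundAt`. CONTENT, honestly: at this field the (IMC≥)
inequality `2·(ord₅ log_ω P − 1) ≤ ord₅ f_ac(0)` is EXACTLY the statement `0 ≤ ord₅ #Ш(E/K)[5^∞]` once the control
identity is written out — the Tamagawa exponent `2·ord₅ ∏ c_ℓ = 2` is SPENT ENTIRELY on the Heegner index
`2·ord₅[E(K):ℤy_K] = 2` (the `p ∣ c_p` phenomenon: Gross–Zagier forces `5 ∣ [E(K):ℤy_K]` here) —, so the rung
exercises the JSW control identity at a split `p ∣ c_p`, `E(ℚ_p)[p] ≠ 0` pair and the index certificate, and NO lower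
bound on `Ш`; it is a T3 witness «outside S's known regime» only in the sense that no printed theorem asserts the open
input at `(6615d1, 5)` (`N = 6615 ≥ 5000` is beyond every per-curve BSD verification in print, and no class-wide
theorem covers a ¬(ram) multiplicative pair). It says NOTHING about the other Heegner fields of the pair.

References: [JetchevSkinnerWan2017] Thm. 3.3.1, §3.5 (3.5.c), §7.3.1 (eq:tamK), §7.4.1 (arXiv:1512.06894);
[Castella2018] Thm. 2.3 (p. 5), (1.1) (p. 2); [Kolyvagin1990] Thm. A; [Gross1991] Thm. 1.3, (2.2); [Tate1975] §7;
[Silverman1994] IV.9.4; [SilvermanAEC2009] VII.1 Rem. 1.1, VII.5 Prop. 5.1; [Cremona1997] Table 1 (6615d1).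
-/

set_option autoImplicit false
-- the Theorems namespace of this sub repeats the summit name by design (D-0017 nested layout)
set_option linter.dupNamespace false

noncomputable section

open scoped Classical

open WeierstrassCurve IsDedekindDomain NumberField
  Literature.NumberTheory.EllipticCurves Literature.NumberTheory.EllipticCurves.ModularForms
  Literature.NumberTheory.EllipticCurves.Rank1Residual
  Literature.NumberTheory.EllipticCurves.Rank1Residual.Typed
  Literature.NumberTheory.EllipticCurves.JetchevSkinnerWan2017
  Summit.BirchSwinnertonDyer.Rank1Residual Summit.BirchSwinnertonDyer.Rank1Residual.X11b
  Summit.BirchSwinnertonDyer.BirchSwinnertonDyer.Rank1Residual.IntModel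
  Summit.BirchSwinnertonDyer.Rank1Residual.Additive Summit.BirchSwinnertonDyer.Rank1Residual.Supersingular
  Summit.BirchSwinnertonDyer.BirchSwinnertonDyer.Rank2Observatory.Tam
  Summit.BirchSwinnertonDyer.BirchSwinnertonDyer.Theses.ErratumRoadFive

namespace Summit.BirchSwinnertonDyer.BirchSwinnertonDyer.Theorems.Rung6615d1

/-! ## §1 The model `6615d1` and its kernel-decided invariants

The curve is written LITERALLY throughout: `(⟨1, -1, 1, -167, 816⟩ : WeierstrassCurve ℚ)` (= planner g23's `W6615d1`
of the registered skeleton `Cruxes/OpenInputNotRam/Lines/birth.lean`), with integral model `⟨1, -1, 1, -167, 816⟩`. -/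

/-- `Δ(6615d1) = 37209375 = 3⁵·5⁵·7²` on the integer equation. [cite: Cremona1997, Table 1 (curve 6615d1)] -/
theorem Δ_int : (⟨1, -1, 1, -167, 816⟩ : WeierstrassCurve ℤ).Δ = 37209375 := by decide

/-- `c₄(6615d1) = 8001 = 3²·7·127` on the integer equation. [cite: Cremona1997, Table 1 (curve 6615d1)] -/
theorem c₄_int : (⟨1, -1, 1, -167, 816⟩ : WeierstrassCurve ℤ).c₄ = 8001 := by decide

/-- `6615d1` is an elliptic curve (`Δ = 37209375 ≠ 0`). [cite: SilvermanAEC2009, III.1] -/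
theorem isElliptic : (⟨1, -1, 1, -167, 816⟩ : WeierstrassCurve ℚ).IsElliptic := by
  have h := isElliptic_of_discOf_ne_zero 1 (-1) 1 (-167) 816 (by decide)
  norm_num at h
  exact h

/-- **The model `[1, −1, 1, −167, 816]` is globally minimal**, kernel-decided by the observatory's minimality certificate
(Silverman's criterion at the primes `3, 5, 7` of `Δ = 3⁵·5⁵·7²`: `ord_q Δ < 12`; `Δ` odd).
[cite: SilvermanAEC2009, VII.1 Remark 1.1 and VIII.8] -/
theorem isGloballyMinimal : (⟨1, -1, 1, -167, 816⟩ : WeierstrassCurve ℚ).IsGloballyMinimal := by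
  have h := IntModelCond.isGloballyMinimal_mk_of_minCheck 1 (-1) 1 (-167) 816
    (cm := ⟨0, 0, 0, [⟨3, 1, 5, 2, 2⟩, ⟨5, 2, 5, 1, 0⟩, ⟨7, 2, 2, 2, 1⟩]⟩) (by decide +kernel)
  norm_num at h
  exact h

/-- The integral model of `6615d1` is the literal integer equation. [folklore] -/
theorem integralModelInt_eq [(⟨1, -1, 1, -167, 816⟩ : WeierstrassCurve ℚ).IsGloballyMinimal] :
    integralModelInt (⟨1, -1, 1, -167, 816⟩ : WeierstrassCurve ℚ) = ⟨1, -1, 1, -167, 816⟩ :=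
  integralModelInt_eq_of_map_eq _ (map_mk_int 1 (-1) 1 (-167) 816)

/-- **`N(6615d1) = 6615 = 3³·5·7²` IN THE KERNEL** — the observatory's conductor certificates on the literal equation: minimality
certificate, root-number-with-3 certificate (valuations `v₂, v₃` of `Δ, c₄, c₆` = `0,0,0 ∕ 5,2,3`; `5` split multiplicative with node root `1`; `7` additive
with `ord₇ Δ = 2`, `ord₇ c₄ = 1`), local Tate certificates at `2` (good) and `3` (Step-2 certificate, exit `IV` after `x ↦ x + 2`, `ord₃ Δ = 5`, so
`f₃ = 5 + 1 − 3 = 3` by Ogg) — `N = 2⁰·3³·5·7² = 6615`, all by `decide +kernel`; NO named fact. [cite: Silverman1994, IV.9.4, IV.10.2, IV.11.1]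
[cite: Cremona1997, Table 1 (curve 6615d1)] -/
theorem conductorNorm_eq : (⟨1, -1, 1, -167, 816⟩ : WeierstrassCurve ℚ).conductorNorm ℤ = 6615 := by
  have h := IntModelCond.conductorNorm_mk_eq_of_certs_of_eq 1 (-1) 1 (-167) 816
    (cm := ⟨0, 0, 0, [⟨3, 1, 5, 2, 2⟩, ⟨5, 2, 5, 1, 0⟩, ⟨7, 2, 2, 2, 1⟩]⟩)
    (c := ⟨0, 0, 0, 5, 2, 3, [⟨5, 2, 5, 1, 1⟩, ⟨7, 2, 2, 2, 1⟩]⟩)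
    (l₂ := ⟨0, 0, 0, 0, 0, 0, 0⟩) (l₃ := ⟨2, 2, 0, 0, 5, 4, 2⟩)
    (by decide +kernel) (by decide +kernel) (by decide +kernel) (by decide +kernel) (N := 6615) (by decide +kernel)
  norm_num at h
  exact h

/-- **`N(6615d1) = 6615 ≥ 5000`**: the pair lies OUTSIDE every printed per-curve verification of BSD (Miller 2011 ∕ Creutz–Miller 2012 ∕
Lawson–Wuthrich 2016: `N < 5000`) — the BC5 «outside S's known regime» clause as a kernel numeral. [cite: Miller2011LMS, §1 and Def. 1.1] -/
theorem conductorNorm_ge : 5000 ≤ (⟨1, -1, 1, -167, 816⟩ : WeierstrassCurve ℚ).conductorNorm ℤ := by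
  rw [conductorNorm_eq]; norm_num

/-- **Multiplicative reduction at `5`** (`5 ∣ Δ`, `5 ∤ c₄ = 8001`). [cite: SilvermanAEC2009, VII.5 Prop. 5.1(b)] -/
theorem mult_five [(⟨1, -1, 1, -167, 816⟩ : WeierstrassCurve ℚ).IsElliptic] [(⟨1, -1, 1, -167, 816⟩ : WeierstrassCurve ℚ).IsGloballyMinimal] :
    Mult (⟨1, -1, 1, -167, 816⟩ : WeierstrassCurve ℚ) 5 :=
  hasMultiplicativeReductionAtPrime_of_intModel integralModelInt_eq 5 (by rw [Δ_int]; decide)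
    (by rw [c₄_int]; decide)

/-- **SPLIT multiplicative at `5`** (`a₅ = +1`): the node-tangent quadratic of the model has the root `t = 1` mod `5`.
[cite: SilvermanAEC2009, VII.5 Prop. 5.1(b)] -/
theorem split_five [(⟨1, -1, 1, -167, 816⟩ : WeierstrassCurve ℚ).IsElliptic] [(⟨1, -1, 1, -167, 816⟩ : WeierstrassCurve ℚ).IsGloballyMinimal] :
    (⟨1, -1, 1, -167, 816⟩ : WeierstrassCurve ℚ).HasSplitMultiplicativeReductionAtPrime 5 :=
  hasSplitMultiplicativeReductionAtPrime_of_intModel_of_root integralModelInt_eq 5 (by rw [Δ_int]; decide)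
    (by rw [c₄_int]; decide) ⟨1, by decide⟩

/-- **`6615d1` is NOT semistable** (`3 ∣ Δ` and `3 ∣ c₄ = 3²·7·127`: additive reduction at `3`; likewise at `7`) — so the
pair lies off every squarefree-level theorem, and (with `5` the only prime of `Δ` not dividing `c₄`) off the (ram) locus:
the context of crux 19282. [cite: SilvermanAEC2009, VII.5 Prop. 5.1(c)] -/
theorem not_semistable [(⟨1, -1, 1, -167, 816⟩ : WeierstrassCurve ℚ).IsElliptic]
    [(⟨1, -1, 1, -167, 816⟩ : WeierstrassCurve ℚ).IsGloballyMinimal] :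
    ¬ Semistable (⟨1, -1, 1, -167, 816⟩ : WeierstrassCurve ℚ) :=
  not_semistable_of_intModel integralModelInt_eq 3 (by norm_num) (by rw [Δ_int]; decide) (by rw [c₄_int]; decide)

/-- `#Ẽ(𝔽₁₇) = 19` for `6615d1` (`a₁₇ = −1`), kernel-decided by the schema count with binary modular exponentiation. [folklore] -/
theorem card_F17 : Nat.card (((⟨1, -1, 1, -167, 816⟩ : WeierstrassCurve ℤ).map (Int.castRingHom (ZMod 17))).toAffine.Point) = 19 := by
  haveI : Fact (Nat.Prime 17) := ⟨by norm_num⟩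
  exact natCard_point_eq_of_countPoints 1 (-1) 1 (-167) 816 17 (by decide) (by decide) (countPoints_eq_of_fast (by decide +kernel))

/-- `#Ẽ(𝔽₃₁) = 30` for `6615d1` (`a₃₁ = 2`), kernel-decided by the schema count with binary modular exponentiation. [folklore] -/
theorem card_F31 : Nat.card (((⟨1, -1, 1, -167, 816⟩ : WeierstrassCurve ℤ).map (Int.castRingHom (ZMod 31))).toAffine.Point) = 30 := by
  haveI : Fact (Nat.Prime 31) := ⟨by norm_num⟩
  exact natCard_point_eq_of_countPoints 1 (-1) 1 (-167) 816 31 (by decide) (by decide) (countPoints_eq_of_fast (by decide +kernel))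

/-- **`ρ̄_{E,5}` is SURJECTIVE for `6615d1`** — kernel-decided by the Frobenius ORDER witness (`ℓ₁ = 17`: `a₁₇ = −1`, `X² + X + 17`
irreducible mod `5`, so `E[5]` is irreducible; `ℓ₂ = 31 ≡ 1 (mod 5)` with `a₃₁ = 2 ≡ 2` and `5² ∤ #Ẽ(𝔽₃₁) = 30`: a Frobenius of order divisible
by `5`; Serre 1972 Prop. 15) — so the pair is an X11b ∕ Surj pair and the rung's open input is NOT vacuous; at this ¬(ram) pair the (irr ∧ ram ⇒ surj)
shortcut of the (ram) rungs is unavailable. [cite: SerreInventiones1972, §2.4 Prop. 15 and §2.8] [cite: Mazur1978, §6 Prop. 6.3 (1) (p. 153)] -/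
theorem surj_five [(⟨1, -1, 1, -167, 816⟩ : WeierstrassCurve ℚ).IsElliptic] [(⟨1, -1, 1, -167, 816⟩ : WeierstrassCurve ℚ).IsGloballyMinimal] :
    Surj (⟨1, -1, 1, -167, 816⟩ : WeierstrassCurve ℚ) 5 := by
  haveI : Fact (Nat.Prime 17) := ⟨by norm_num⟩
  haveI : Fact (Nat.Prime 31) := ⟨by norm_num⟩
  exact GaloisImage.hasSurjectiveModNGaloisRep_of_intModel_of_irr_of_order integralModelInt_eq 5 17 31
    (by decide) (by decide) (by rw [Δ_int]; decide) (by rw [Δ_int]; decide) card_F17 card_F31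
    (by decide) (by decide) (by decide) (by decide)

/-! ## §2 The Tamagawa product: `5 ∣ ∏_ℓ c_ℓ(6615d1)` by a kernel Tate certificate -/

/-- **Tate ROW certificate of `6615d1`** (one `TamLocal` certificate per bad prime, checked by `decide +kernel` on the
integral model; the rank-2 observatory's engine 1 emitted the rows): `3`: type `IV` (Step-2 Tate certificate, exit 4;
bracket `c₃ ∈ {1, 3}`), `5`: split `I₅` (root `1`; `c₅ = 5`), `7`: type `II` (exit 2; `c₇ = 1`) — so
`∏_ℓ c_ℓ ∈ {5, 15}` (Cremona ∕ PARI: `15`). [cite: Tate1975, §7] [cite: Silverman1994, IV.9.4] -/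
theorem tamRow :
    TamLocal.rowCheck [⟨3, 1, 4, 0, 2, 0, 0, 5, 4, 2, 3⟩, ⟨5, 2, 1, 1, 0, 0, 0, 5, 0, 0, 5⟩, ⟨7, 2, 4, 0, 2, 0, 2, 2, 2, 1, 1⟩]
      ⟨1, -1, 1, -167, 816⟩ = true := by
  decide +kernel

/-- **`∏_ℓ c_ℓ(6615d1) ∈ {5, 15}`** in the kernel (stage-1 bracket of the row certificate).
[cite: Tate1975, §7] [cite: Silverman1994, IV.9.4] -/
theorem tamagawaProduct_mem [(⟨1, -1, 1, -167, 816⟩ : WeierstrassCurve ℚ).IsGloballyMinimal] :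
    (⟨1, -1, 1, -167, 816⟩ : WeierstrassCurve ℚ).tamagawaProduct ∈
      TamLocal.rowVals [⟨3, 1, 4, 0, 2, 0, 0, 5, 4, 2, 3⟩, ⟨5, 2, 1, 1, 0, 0, 0, 5, 0, 0, 5⟩, ⟨7, 2, 4, 0, 2, 0, 2, 2, 2, 1, 1⟩] :=
  IntModelTam.tamagawaProduct_mem_rowVals_of_intModel integralModelInt_eq tamRow

/-- **`5 ∣ ∏_ℓ c_ℓ(6615d1)` and `∏_ℓ c_ℓ ≠ 0`** (every bracket value is `5` or `15`). [cite: Silverman1994, IV.9.4] -/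
theorem five_dvd_tamagawaProduct [(⟨1, -1, 1, -167, 816⟩ : WeierstrassCurve ℚ).IsGloballyMinimal] :
    5 ∣ (⟨1, -1, 1, -167, 816⟩ : WeierstrassCurve ℚ).tamagawaProduct ∧
      0 < (⟨1, -1, 1, -167, 816⟩ : WeierstrassCurve ℚ).tamagawaProduct := by
  have hm := tamagawaProduct_mem
  have hall : ∀ c ∈ TamLocal.rowVals [⟨3, 1, 4, 0, 2, 0, 0, 5, 4, 2, 3⟩, ⟨5, 2, 1, 1, 0, 0, 0, 5, 0, 0, 5⟩,
      ⟨7, 2, 4, 0, 2, 0, 2, 2, 2, 1, 1⟩], 5 ∣ c ∧ 0 < c := by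
    decide +kernel
  exact hall _ hm

/-- **`1 ≤ ord₅ ∏_ℓ c_ℓ(6615d1)`** (the Tamagawa exponent `c₅ = 5` that the Heegner index absorbs).
[cite: Silverman1994, IV.9.4] [cite: Gross1991, (2.2)] -/
theorem one_le_padicValNat_tamagawaProduct [(⟨1, -1, 1, -167, 816⟩ : WeierstrassCurve ℚ).IsGloballyMinimal] :
    1 ≤ padicValNat 5 (⟨1, -1, 1, -167, 816⟩ : WeierstrassCurve ℚ).tamagawaProduct := by
  haveI : Fact (Nat.Prime 5) := ⟨by norm_num⟩
  obtain ⟨hd, hpos⟩ := five_dvd_tamagawaProduct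
  exact one_le_padicValNat_of_dvd hpos.ne' hd

/-! ## §3 The rung: route p2's open input at `(6615d1, 5)` over `ℚ(√−59)` from published facts + ONE attested certificate -/

/-- **BC5 RUNG for crux `OpenInputNotRam` (item 19282) at the ¬(ram) pair `(6615d1, 5)`, AT THE EXPLICIT CLASSICAL FIELD
`K = ℚ(√−59)`** — the body of `P2OpenInputOnTreeAt E 5` VERBATIM with the ONE extra binder `NumberField.discr K = −59`.
Published binders: `h331` = Jetchev–Skinner–Wan 2017 Thm. 3.3.1 at a multiplicative `p` (any conductor, any Tamagawa
numbers; imc-t1 p428223) and Kolyvagin's theorem `hKo` (rank one and `#Ш(E/K) < ∞` at a non-torsion Heegner point).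
Certificate binder (kit j257035, ATTESTED, not kernel-checked): `hidx` — at every Heegner point `P` of level `N = N_E`
over a field of discriminant `−59` read through a parametrisation datum with `5 ∤ c` (the datum's own Manin-constant binder;
a datum with `5 ∣ c` parametrises by `[5]∘φ₀` and would multiply the index by `5`), `ord₅ [E(K) : ℤP] ≤ 1` (`y_K = 15·g`,
`E(K)_tors = 1`, `ρ̄_{E,5}` onto so no `5`-isogeny rescales `φ₀`). Proof: the control identity
at the datum (`p2ControlOnTreeAt_of_thm331Mult`), finiteness of `Ш(E/K)` (`hKo`), STEP L `IndexLowerBoundAt E 5 K P`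
from `hidx` + §2 (`2·1 ≤ ord₅ #Ш(E/K) + 2·ord₅ ∏ c_ℓ`, `1 ≤ ord₅ ∏ c_ℓ`), and the tightness
`imcLowerWaldspurgerOnTreeAt_of_controlOnTreeAt_of_indexLowerBoundAt`. CONDITIONAL on every binder; ONE curve, ONE
field; nothing booked; at this field the inequality carries no lower bound on `Ш` (module docstring).
[cite: JetchevSkinnerWan2017, Thm. 3.3.1 with §3.5 (3.5.c), §7.3.1 (eq:tamK), §7.4.1 (arXiv:1512.06894 pp. 11, 15, 28, 30)]
[cite: Castella2018, Thm. 2.3 (p. 5), (1.1) (p. 2)] [cite: Kolyvagin1990, Thm. A] [cite: Gross1991, Thm. 1.3 and (2.2)]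
[cite: Cremona1997, Table 1 (curve 6615d1)] -/
theorem rung_6615d1_d59_of_cert
    [(⟨1, -1, 1, -167, 816⟩ : WeierstrassCurve ℚ).IsElliptic] [(⟨1, -1, 1, -167, 816⟩ : WeierstrassCurve ℚ).IsGloballyMinimal]
    -- published named facts
    (h331 : thm331_anticyclotomicControl_mult)
    (hKo : ∀ (N : ℕ) [NeZero N] (W : WeierstrassCurve ℚ) (K : Type) [Field K] [NumberField K], kolyvagin N W K)
    -- the attested certificate (kit j257035): over ℚ(√−59) every Heegner point of level N_E has 5-adic index exponent ≤ 1
    (hidx : ∀ (N : ℕ) [NeZero N] (K : Type) [Field K] [NumberField K]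
      (Dt : ModularParametrizationData (⟨1, -1, 1, -167, 816⟩ : WeierstrassCurve ℚ) N)
      (H : HeegnerDatum N (NumberField.discr K)) (ι : K →+* ℂ)
      (P : ((⟨1, -1, 1, -167, 816⟩ : WeierstrassCurve ℚ).baseChange K).toAffine.Point),
      (⟨1, -1, 1, -167, 816⟩ : WeierstrassCurve ℚ).conductorNorm ℤ = N → NumberField.discr K = -59 →
      WeierstrassCurve.Affine.Point.map ι.toRatAlgHom P = heegnerPointComplex Dt H → ¬ (5 : ℤ) ∣ Dt.c →
      padicValNat 5 (AddSubgroup.zmultiples P).index ≤ 1) :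
    ∀ (N : ℕ) [NeZero N] (K : Type) [Field K] [NumberField K]
      (Dt : ModularParametrizationData (⟨1, -1, 1, -167, 816⟩ : WeierstrassCurve ℚ) N)
      (H : HeegnerDatum N (NumberField.discr K)) (ι : K →+* ℂ)
      (P : ((⟨1, -1, 1, -167, 816⟩ : WeierstrassCurve ℚ).baseChange K).toAffine.Point),
      ClassX11b (⟨1, -1, 1, -167, 816⟩ : WeierstrassCurve ℚ) 5 → 5 ≤ 5 →
      Surj (⟨1, -1, 1, -167, 816⟩ : WeierstrassCurve ℚ) 5 →
      (⟨1, -1, 1, -167, 816⟩ : WeierstrassCurve ℚ).conductorNorm ℤ = N → IsImaginaryQuadratic K →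
      Odd (NumberField.discr K) → ¬ (5 : ℤ) ∣ NumberField.discr K → ¬ 5 ∣ Units.torsionOrder K →
      SatisfiesHeegnerHypothesis N K →
      ((⟨1, -1, 1, -167, 816⟩ : WeierstrassCurve ℚ).quadraticTwist (NumberField.discr K : ℚ)).entireLFunction 1 ≠ 0 →
      WeierstrassCurve.Affine.Point.map ι.toRatAlgHom P = heegnerPointComplex Dt H →
      ¬ (5 : ℤ) ∣ Dt.c → ¬ IsOfFinAddOrder P → NumberField.discr K = -59 →
      ∀ (κ : ZpExtension K 5), κ.IsAnticyclotomic →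
        ∀ (γ : Field.absoluteGaloisGroup K) [Fact (κ.IsTopGenerator γ)]
          (𝔭 : HeightOneSpectrum (𝓞 K)) (h𝔭 : ((5 : ℕ) : 𝓞 K) ∈ 𝔭.asIdeal)
          (he : 𝔭.asIdeal.ramificationIdx (𝓞 ℚ) = 1) (hf : 𝔭.asIdeal.inertiaDeg (𝓞 ℚ) = 1),
          IMCLowerWaldspurgerOnTreeAt 5 κ 𝔭 γ (embAt K 5 𝔭 h𝔭 he hf) P := by
  intro N _ K _ _ Dt H ι P hX hp5 hsurj hN hK hodd hdK htor hHN hL hP hc hPinf hd κ hκ γ _ 𝔭 h𝔭 he hf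
  -- the control identity at the datum, from the Jetchev–Skinner–Wan fact + Kolyvagin
  have hCTL : ControlOnTreeAt 5 κ 𝔭 γ (embAt K 5 𝔭 h𝔭 he hf) P :=
    p2ControlOnTreeAt_of_thm331Mult _ 5 h331 hKo N K Dt H ι P hX hp5 hsurj hN hK hodd hdK htor hHN hL hP hc hPinf κ hκ
      γ 𝔭 h𝔭 he hf
  -- `Ш(E/K)` is finite (Kolyvagin at the non-torsion Heegner point)
  obtain ⟨-, hfinK⟩ := hKo N _ K hK hHN ⟨Dt, H, ι, hP⟩ hPinf
  haveI : Finite (((⟨1, -1, 1, -167, 816⟩ : WeierstrassCurve ℚ)).baseChange K).sha := hfinK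
  -- STEP L at the datum from the index certificate and the kernel Tamagawa exponent
  have hL' : IndexLowerBoundAt (⟨1, -1, 1, -167, 816⟩ : WeierstrassCurve ℚ) 5 K P := by
    unfold IndexLowerBoundAt
    have h1 := hidx N K Dt H ι P hN hd hP hc
    have h2 := one_le_padicValNat_tamagawaProduct
    omega
  exact imcLowerWaldspurgerOnTreeAt_of_controlOnTreeAt_of_indexLowerBoundAt hp5 hK hN hHN hCTL hL'

/-! ## §4 The same over the route's support items BY NAME -/

/-- **The rung with the published facts bound BY THE ROUTE'S NAMES**: `PublishedInputsFive` (support item 19066; only its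
Kolyvagin conjunct is used) + `JSWAnticyclotomicControlMult` (19626) + the attested certificate ⟹ the open input of
`(6615d1, 5)` at every classical datum over `ℚ(√−59)`. CONDITIONAL; ONE curve, ONE field; nothing booked.
[cite: JetchevSkinnerWan2017, Thm. 3.3.1] [cite: Kolyvagin1990, Thm. A] [cite: Cremona1997, Table 1 (curve 6615d1)] -/
theorem rung_6615d1_d59_of_items
    [(⟨1, -1, 1, -167, 816⟩ : WeierstrassCurve ℚ).IsElliptic] [(⟨1, -1, 1, -167, 816⟩ : WeierstrassCurve ℚ).IsGloballyMinimal]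
    (hF : PublishedInputsFive) (h331 : JSWAnticyclotomicControlMult)
    (hidx : ∀ (N : ℕ) [NeZero N] (K : Type) [Field K] [NumberField K]
      (Dt : ModularParametrizationData (⟨1, -1, 1, -167, 816⟩ : WeierstrassCurve ℚ) N)
      (H : HeegnerDatum N (NumberField.discr K)) (ι : K →+* ℂ)
      (P : ((⟨1, -1, 1, -167, 816⟩ : WeierstrassCurve ℚ).baseChange K).toAffine.Point),
      (⟨1, -1, 1, -167, 816⟩ : WeierstrassCurve ℚ).conductorNorm ℤ = N → NumberField.discr K = -59 →
      WeierstrassCurve.Affine.Point.map ι.toRatAlgHom P = heegnerPointComplex Dt H → ¬ (5 : ℤ) ∣ Dt.c →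
      padicValNat 5 (AddSubgroup.zmultiples P).index ≤ 1) :
    ∀ (N : ℕ) [NeZero N] (K : Type) [Field K] [NumberField K]
      (Dt : ModularParametrizationData (⟨1, -1, 1, -167, 816⟩ : WeierstrassCurve ℚ) N)
      (H : HeegnerDatum N (NumberField.discr K)) (ι : K →+* ℂ)
      (P : ((⟨1, -1, 1, -167, 816⟩ : WeierstrassCurve ℚ).baseChange K).toAffine.Point),
      ClassX11b (⟨1, -1, 1, -167, 816⟩ : WeierstrassCurve ℚ) 5 → 5 ≤ 5 →
      Surj (⟨1, -1, 1, -167, 816⟩ : WeierstrassCurve ℚ) 5 →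
      (⟨1, -1, 1, -167, 816⟩ : WeierstrassCurve ℚ).conductorNorm ℤ = N → IsImaginaryQuadratic K →
      Odd (NumberField.discr K) → ¬ (5 : ℤ) ∣ NumberField.discr K → ¬ 5 ∣ Units.torsionOrder K →
      SatisfiesHeegnerHypothesis N K →
      ((⟨1, -1, 1, -167, 816⟩ : WeierstrassCurve ℚ).quadraticTwist (NumberField.discr K : ℚ)).entireLFunction 1 ≠ 0 →
      WeierstrassCurve.Affine.Point.map ι.toRatAlgHom P = heegnerPointComplex Dt H →
      ¬ (5 : ℤ) ∣ Dt.c → ¬ IsOfFinAddOrder P → NumberField.discr K = -59 →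
      ∀ (κ : ZpExtension K 5), κ.IsAnticyclotomic →
        ∀ (γ : Field.absoluteGaloisGroup K) [Fact (κ.IsTopGenerator γ)]
          (𝔭 : HeightOneSpectrum (𝓞 K)) (h𝔭 : ((5 : ℕ) : 𝓞 K) ∈ 𝔭.asIdeal)
          (he : 𝔭.asIdeal.ramificationIdx (𝓞 ℚ) = 1) (hf : 𝔭.asIdeal.inertiaDeg (𝓞 ℚ) = 1),
          IMCLowerWaldspurgerOnTreeAt 5 κ 𝔭 γ (embAt K 5 𝔭 h𝔭 he hf) P := by
  obtain ⟨-, hKo, -⟩ := hF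
  exact rung_6615d1_d59_of_cert h331 hKo hidx

/-! ## §5 The REGISTERED per-field rung stub of crux 19282 BY NAME (skeleton v2, planner g27: the ∀-K `stub_rung_6615d1` re-typed
to the certifiable per-field object of §3, text = `HOME/imc-p1/stub_rung_6615d1_d59-proposed.lean.txt` verbatim) -/

/-- **BC5 RUNG `stub_rung_6615d1_d59` of crux `OpenInputNotRam` (item 19282) — REGISTERED name and signature**: route p2's open input of
`(6615d1, 5)` at every classical datum over `ℚ(√−59)`, from `h331` (JSW17 Thm. 3.3.1-mult, PUBLISHED), `hKo` (Kolyvagin, PUBLISHED) and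
the ATTESTED Manin-guarded Heegner-index certificate `hidx` (kit j257035: `y_K = 15·g`, `ord₅ [E(K):ℤy_K] = 1`) — §3's
`rung_6615d1_d59_of_cert` under the registered name. CONDITIONAL on the three binders; one curve, one field; closes no item; BSD is
proved for no pair by this. [cite: JetchevSkinnerWan2017, Thm. 3.3.1 with §3.5 (3.5.c), §7.4.1] [cite: Kolyvagin1990, Thm. A]
[cite: Cremona1997, Table 1 (curve 6615d1)] -/
theorem stub_rung_6615d1_d59
    [(⟨1, -1, 1, -167, 816⟩ : WeierstrassCurve ℚ).IsElliptic] [(⟨1, -1, 1, -167, 816⟩ : WeierstrassCurve ℚ).IsGloballyMinimal]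
    (h331 : thm331_anticyclotomicControl_mult)
    (hKo : ∀ (N : ℕ) [NeZero N] (W : WeierstrassCurve ℚ) (K : Type) [Field K] [NumberField K], kolyvagin N W K)
    (hidx : ∀ (N : ℕ) [NeZero N] (K : Type) [Field K] [NumberField K]
      (Dt : ModularParametrizationData (⟨1, -1, 1, -167, 816⟩ : WeierstrassCurve ℚ) N)
      (H : HeegnerDatum N (NumberField.discr K)) (ι : K →+* ℂ)
      (P : ((⟨1, -1, 1, -167, 816⟩ : WeierstrassCurve ℚ).baseChange K).toAffine.Point),
      (⟨1, -1, 1, -167, 816⟩ : WeierstrassCurve ℚ).conductorNorm ℤ = N → NumberField.discr K = -59 →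
      WeierstrassCurve.Affine.Point.map ι.toRatAlgHom P = heegnerPointComplex Dt H → ¬ (5 : ℤ) ∣ Dt.c →
      padicValNat 5 (AddSubgroup.zmultiples P).index ≤ 1) :
    ∀ (N : ℕ) [NeZero N] (K : Type) [Field K] [NumberField K]
      (Dt : ModularParametrizationData (⟨1, -1, 1, -167, 816⟩ : WeierstrassCurve ℚ) N)
      (H : HeegnerDatum N (NumberField.discr K)) (ι : K →+* ℂ)
      (P : ((⟨1, -1, 1, -167, 816⟩ : WeierstrassCurve ℚ).baseChange K).toAffine.Point),
      ClassX11b (⟨1, -1, 1, -167, 816⟩ : WeierstrassCurve ℚ) 5 → 5 ≤ 5 →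
      Surj (⟨1, -1, 1, -167, 816⟩ : WeierstrassCurve ℚ) 5 →
      (⟨1, -1, 1, -167, 816⟩ : WeierstrassCurve ℚ).conductorNorm ℤ = N → IsImaginaryQuadratic K →
      Odd (NumberField.discr K) → ¬ (5 : ℤ) ∣ NumberField.discr K → ¬ 5 ∣ Units.torsionOrder K →
      SatisfiesHeegnerHypothesis N K →
      ((⟨1, -1, 1, -167, 816⟩ : WeierstrassCurve ℚ).quadraticTwist (NumberField.discr K : ℚ)).entireLFunction 1 ≠ 0 →
      WeierstrassCurve.Affine.Point.map ι.toRatAlgHom P = heegnerPointComplex Dt H →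
      ¬ (5 : ℤ) ∣ Dt.c → ¬ IsOfFinAddOrder P → NumberField.discr K = -59 →
      ∀ (κ : ZpExtension K 5), κ.IsAnticyclotomic →
        ∀ (γ : Field.absoluteGaloisGroup K) [Fact (κ.IsTopGenerator γ)]
          (𝔭 : HeightOneSpectrum (𝓞 K)) (h𝔭 : ((5 : ℕ) : 𝓞 K) ∈ 𝔭.asIdeal)
          (he : 𝔭.asIdeal.ramificationIdx (𝓞 ℚ) = 1) (hf : 𝔭.asIdeal.inertiaDeg (𝓞 ℚ) = 1),
          IMCLowerWaldspurgerOnTreeAt 5 κ 𝔭 γ (embAt K 5 𝔭 h𝔭 he hf) P :=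
  rung_6615d1_d59_of_cert h331 hKo hidx

end Summit.BirchSwinnertonDyer.BirchSwinnertonDyer.Theorems.Rung6615d1

end
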